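import Summits.Schanuel.Schanuel.Theorems.ZilberEacPerturbedEdgeChart
import HarnessLib

/-!
# The exponential-polynomial regime, CVIII (b): EXPONENTIAL POINTS BY PERTURBATION OF A
# DEGENERATE FIBRE RELATION — the abstract existence theorem

HONEST FRAMING.  Cell `pub-schanuel` (Zilber's Exponential-Algebraic Closedness, case ladder;
host summit Schanuel), seat 2, gen 34.  Every existence theorem of the cell so far produces
exponential points of a surface `W ⊆ ℂ² × (ℂˣ)²` whose fibre relation involves ONE multiplicative
coordinate (`y₀ = ψ(s)s^L` along a place of the base curve: file XXXI `exists_poleFibre_expPoints`;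
cylinders, fibre curves).  A relation `G(x; y₀, y₁) = 0` involving BOTH `y₀` and `y₁` along an
UNBOUNDED place is Mantova–Masser's exponential-polynomial regime: with `x₀ = s^{-k}`,
`x₁ = Φ(s)s^{-M}` both exponentials `e^{s^{-k}}`, `e^{Φ(s)s^{-M}}` are wild at `s = 0`.  This file
is the analytic core of a first general mechanism there.  In a direction `s ≈ z^{-1}t`
(`z^k = 2πi`, `t → 0⁺`) in which `e^{x₀}` is moderate while `y₁ = e^{x₁} → 0` super-exponentially,
the relation is a small perturbation of its DEGENERATE part `G(x; y₀, 0) = 0`; after the weighted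
normalisation `y₀ = s^L Ỹ` the degenerate part has analytic rows `α_i(s)` and an EDGE polynomial
`E(Ỹ) = Σ α_i(0) Ỹ^i` with a nonzero root `θ`.  **`exists_expPoints_perturbedEdge`**: given such
rows, `E(θ) = 0`, `θ ≠ 0`, `E ≢ 0` on `ℂˣ`, and ANY perturbation `P(s, Ỹ)` that is holomorphic for
small `s ≠ 0` and tends to `0` in the sector `s = z^{-1}tu` (`t → 0⁺`, `u → 1`) uniformly for `Ỹ`
bounded, there is a sequence `s_j → 0`, `s_j = z^{-1}e^{-log(N₀+j)/k}u_j`, `u_j → 1`, with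
`Σ α_i(s_j) Ỹ_j^i + P(s_j, Ỹ_j) = 0`, `Ỹ_j = e^{s_j^{-k}} s_j^{-L}` — i.e. `y₀ = e^{x₀}` solves the
perturbed relation.  Proof: the chart of file XXXI / CVIII (a) (`x₀ = 2πin − (L/k)log n + w`, so
that `Ỹ = z^L e^w e^{(L/k)Log q}`), uniform convergence of the charted relation to the entire
function `w ↦ E(z^L e^w)` on a ball around `w₀ = Log(θ z^{-L})`, and the minimum-modulus zero lemma
(`exists_zero_of_norm_lt_of_sphere`, the tree's Rouché substitute).  Infrastructure [folklore
analysis, new in this form]; no density statement here.  Mantova–Masser's question (PLMS 2024 §1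
p. 5) stays OPEN; EC(3,2) OPEN; NOT Schanuel's conjecture (neither used nor implied); EAC ⇏ SC.
-/

noncomputable section

open Filter Topology Metric Complex

set_option linter.dupNamespace false

namespace Summit.Schanuel.Schanuel.Theorems

/-- **EXPONENTIAL POINTS BY PERTURBATION OF A DEGENERATE FIBRE RELATION (abstract form).**
Let `k ≥ 1`, `z^k = 2πi`, `L ∈ ℤ`; rows `α_0, …, α_d` analytic at `0` with EDGE polynomial
`E(Y) = Σ_{i ≤ d} α_i(0) Y^i` having a nonzero root `θ` and a nonzero value at some `Y ≠ 0`; a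
perturbation `P(σ, Y)`, jointly holomorphic for `0 < ‖σ‖ < δ₀`, with `P(z^{-1}tu, Y) → 0` as
`t → 0⁺`, `u → 1` uniformly for `‖Y‖ ≤ R` (every `R`).  Then there are `N₀ ≥ 1`, `u_j → 1` and
`s_j = z^{-1}e^{-log(N₀+j)/k}u_j` (`s_j ≠ 0`, `s_j → 0`) with
`Σ_{i ≤ d} α_i(s_j) Ỹ_j^i + P(s_j, Ỹ_j) = 0`, `Ỹ_j = exp(s_j^{-k})·s_j^{-L}`.
[folklore analysis: minimum-modulus zero lemma in the chart of file XXXI] (new) -/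
theorem exists_expPoints_perturbedEdge {k : ℕ} (hk : 1 ≤ k) (L : ℤ) {z : ℂ}
    (hz : z ^ k = 2 * Real.pi * I) (d : ℕ) {α : ℕ → ℂ → ℂ} (hα : ∀ i, AnalyticAt ℂ (α i) 0)
    {θ : ℂ} (hθ0 : θ ≠ 0) (hθ : ∑ i ∈ Finset.range (d + 1), α i 0 * θ ^ i = 0)
    (hE : ∃ Y : ℂ, Y ≠ 0 ∧ ∑ i ∈ Finset.range (d + 1), α i 0 * Y ^ i ≠ 0)
    {P : ℂ → ℂ → ℂ} {δ₀ : ℝ} (hδ₀ : 0 < δ₀)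
    (hPd : ∀ σ Y : ℂ, σ ≠ 0 → ‖σ‖ < δ₀ →
      DifferentiableAt ℂ (fun p : ℂ × ℂ => P p.1 p.2) (σ, Y))
    (hPs : ∀ R > 0, ∀ ε > 0, ∃ δ > 0, ∃ η > 0, ∀ (t : ℝ) (u Y : ℂ), 0 < t → t < δ →
      ‖u - 1‖ < η → ‖Y‖ ≤ R → ‖P (z⁻¹ * t * u) Y‖ < ε) :
    ∃ (N₀ : ℕ) (u s : ℕ → ℂ), 1 ≤ N₀ ∧ Tendsto u atTop (𝓝 1) ∧ (∀ j, u j ≠ 0) ∧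
      (∀ j, s j = z⁻¹ * Complex.exp (-(Real.log ((N₀ + j : ℕ) : ℝ) : ℂ) / k) * u j) ∧
      (∀ j, s j ≠ 0) ∧ Tendsto s atTop (𝓝 0) ∧
      ∀ j, ∑ i ∈ Finset.range (d + 1), α i (s j) * (Complex.exp ((s j ^ k)⁻¹) * (s j ^ L)⁻¹) ^ i +
        P (s j) (Complex.exp ((s j ^ k)⁻¹) * (s j ^ L)⁻¹) = 0 := by
  classical
  have hk0 : k ≠ 0 := by omega
  have h2πI : (2 * Real.pi * I : ℂ) ≠ 0 := by simp [Real.pi_ne_zero, Complex.I_ne_zero]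
  have hz0 : z ≠ 0 := by
    rintro rfl
    rw [zero_pow hk0] at hz
    exact h2πI hz.symm
  -- constants
  set a : ℂ := -(L : ℂ) / k with ha
  set zL : ℂ := (z⁻¹ ^ L)⁻¹ with hzL
  have hzL0 : zL ≠ 0 := inv_ne_zero (zpow_ne_zero _ (inv_ne_zero hz0))
  -- the edge polynomial as an entire function of `w`: `h(w) = E(zL e^w)`
  set Ef : ℂ → ℂ := fun Y => ∑ i ∈ Finset.range (d + 1), α i 0 * Y ^ i with hEf
  set Y₀ : ℂ → ℂ := fun w => zL * Complex.exp w with hY₀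
  set h : ℂ → ℂ := fun w => Ef (Y₀ w) with hh
  have hEfd : Differentiable ℂ Ef := by rw [hEf]; fun_prop
  have hY₀d : Differentiable ℂ Y₀ := by rw [hY₀]; fun_prop
  have hhd : Differentiable ℂ h := hEfd.comp hY₀d
  set w₀ : ℂ := Complex.log (θ * zL⁻¹) with hw₀
  have hY₀w₀ : Y₀ w₀ = θ := by
    simp only [hY₀, hw₀]
    rw [Complex.exp_log (mul_ne_zero hθ0 (inv_ne_zero hzL0))]
    field_simp
  have hhw₀ : h w₀ = 0 := by
    simp only [hh, hY₀w₀, hEf]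
    exact hθ
  have hhne : ∃ w, h w ≠ 0 := by
    obtain ⟨Y, hY0, hY⟩ := hE
    refine ⟨Complex.log (Y * zL⁻¹), ?_⟩
    simp only [hh, hY₀]
    rw [Complex.exp_log (mul_ne_zero hY0 (inv_ne_zero hzL0)),
      show zL * (Y * zL⁻¹) = Y by field_simp]
    exact hY
  obtain ⟨r, hr0, hr1, m, hm0, hm⟩ := exists_sphere_norm_le hhd hhne w₀ one_pos
  -- the radius `R₀` bounding `Y₀` on `closedBall w₀ 2`, and `R₁ = 2 R₀ + 1`
  set R₀ : ℝ := ‖zL‖ * Real.exp (‖w₀‖ + 2) with hR₀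
  have hR₀0 : 0 < R₀ := mul_pos (norm_pos_iff.2 hzL0) (Real.exp_pos _)
  have hY₀b : ∀ w ∈ closedBall w₀ 2, ‖Y₀ w‖ ≤ R₀ := by
    intro w hw
    rw [hY₀]
    simp only [norm_mul, Complex.norm_exp]
    refine mul_le_mul_of_nonneg_left (Real.exp_le_exp.2 ?_) (norm_nonneg _)
    have h1 := mem_closedBall.1 hw
    rw [dist_eq_norm] at h1
    have := norm_le_norm_add_norm_sub' w w₀
    linarith [Complex.re_le_norm w, abs_le.1 (Complex.abs_re_le_norm w)]
  set R₁ : ℝ := 2 * R₀ + 1 with hR₁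
  have hR₁1 : 1 ≤ R₁ := by rw [hR₁]; linarith
  have hR₁0 : 0 < R₁ := by linarith
  -- uniform continuity of `Ef` on `closedBall 0 R₁`
  have hunif := (isCompact_closedBall (0 : ℂ) R₁).uniformContinuousOn_of_continuous
    hEfd.continuous.continuousOn
  obtain ⟨δu, hδu0, hδu⟩ := Metric.uniformContinuousOn_iff.1 hunif (m / 6) (by positivity)
  -- rows close to their values at `0`, differentiable on a common ball
  set ε₁ : ℝ := m / (6 * ((d : ℝ) + 1) * R₁ ^ d) with hε₁
  have hε₁0 : 0 < ε₁ := by positivity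
  obtain ⟨δ₁, hδ₁0, hδ₁⟩ := exists_delta_rows_near_zero d (fun i => (hα i).continuousAt) hε₁0
  obtain ⟨ρ, hρ0, hρ⟩ := exists_ball_rows_differentiable d hα
  -- the perturbation small in the sector
  obtain ⟨δP, hδP0, ηP, hηP0, hPsmall⟩ := hPs R₁ hR₁0 (m / 6) (by positivity)
  -- the `n`-dependent objects (chart of file XXXI)
  set q : ℕ → ℂ → ℂ := fun n w => 1 + (a * (Real.log n : ℂ) + w) / ((n : ℂ) * (2 * Real.pi * I))
    with hq
  set f₁ : ℂ → ℂ := fun q' => Complex.exp (-(Complex.log q') / k) with hf₁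
  set f₃ : ℂ → ℂ := fun q' => Complex.exp ((-a) * Complex.log q') with hf₃
  set Er : ℕ → ℝ := fun n => Real.exp (-(Real.log n) / k) with hEr
  have hEEr : ∀ n : ℕ, Complex.exp (-(Real.log n : ℂ) / k) = ((Er n : ℝ) : ℂ) := by
    intro n
    rw [hEr]
    simp only
    rw [Complex.ofReal_exp]
    push_cast
    ring_nf
  have hEr0 : ∀ n, 0 < Er n := fun n => Real.exp_pos _
  set sf : ℕ → ℂ → ℂ := fun n w => z⁻¹ * ((Er n : ℝ) : ℂ) * f₁ (q n w) with hsf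
  set Yt : ℕ → ℂ → ℂ := fun n w => zL * Complex.exp w * f₃ (q n w) with hYt
  set G : ℕ → ℂ → ℂ := fun n w =>
    ∑ i ∈ Finset.range (d + 1), α i (sf n w) * (Yt n w) ^ i + P (sf n w) (Yt n w) with hG
  -- tolerances and the uniform statement of the chart
  set D : ℝ := min (min δ₁ ρ) δ₀ with hD
  have hD0 : 0 < D := lt_min (lt_min hδ₁0 hρ0) hδ₀
  set ηY : ℝ := min (δu / (2 * R₀)) (1 / 2) with hηY
  have hηY0 : 0 < ηY := lt_min (by positivity) (by norm_num)
  have hzi : 0 < ‖z⁻¹‖ := norm_pos_iff.2 (inv_ne_zero hz0)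
  set η₀ : ℝ := min (min ηY ηP) (min δP (D / (‖z⁻¹‖ * 2 + 1))) with hη₀
  have hη₀0 : 0 < η₀ := lt_min (lt_min hηY0 hηP0) (lt_min hδP0 (by positivity))
  have hev : ∀ η > 0, ∀ᶠ n : ℕ in atTop, 1 ≤ n ∧ Er n < η ∧ ∀ w ∈ closedBall w₀ 2,
      q n w ∈ slitPlane ∧ ‖f₁ (q n w) - 1‖ < η ∧ ‖f₃ (q n w) - 1‖ < η :=
    fun η hη => eventually_chart_uniform k hk a (-a) w₀ hη
  have hmain := hev η₀ hη₀0
  -- consequences of the tolerances for one `n`, `w`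
  have hcons : ∀ n : ℕ, Er n < η₀ → ∀ w ∈ closedBall w₀ 2,
      ‖f₁ (q n w) - 1‖ < η₀ → ‖f₃ (q n w) - 1‖ < η₀ →
      ‖sf n w‖ < D ∧ sf n w ≠ 0 ∧ Er n < δP ∧ ‖f₁ (q n w) - 1‖ < ηP ∧ ‖Yt n w‖ ≤ R₁ ∧
        ‖Yt n w - Y₀ w‖ < δu := by
    intro n hEn w hw hf1 hf3
    have hη₀Y : η₀ ≤ ηY := (min_le_left _ _).trans (min_le_left _ _)
    have hf1' : ‖f₁ (q n w)‖ < 2 := norm_lt_two_of_norm_sub_one_lt hf1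
      (hη₀Y.trans ((min_le_right _ _).trans (by norm_num)))
    have hsfn : ‖sf n w‖ < D := by
      rw [hsf]
      simp only [norm_mul, Complex.norm_real, Real.norm_eq_abs, abs_of_pos (hEr0 n)]
      have hEn' : Er n < D / (‖z⁻¹‖ * 2 + 1) :=
        hEn.trans_le ((min_le_right _ _).trans (min_le_right _ _))
      calc ‖z⁻¹‖ * Er n * ‖f₁ (q n w)‖ ≤ ‖z⁻¹‖ * Er n * 2 :=
            mul_le_mul_of_nonneg_left hf1'.le (by positivity)
        _ < ‖z⁻¹‖ * (D / (‖z⁻¹‖ * 2 + 1)) * 2 := by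
            have : ‖z⁻¹‖ * Er n < ‖z⁻¹‖ * (D / (‖z⁻¹‖ * 2 + 1)) := mul_lt_mul_of_pos_left hEn' hzi
            linarith
        _ = D * (‖z⁻¹‖ * 2 / (‖z⁻¹‖ * 2 + 1)) := by ring
        _ ≤ D * 1 := by
            refine mul_le_mul_of_nonneg_left ?_ hD0.le
            rw [div_le_one (by positivity)]
            linarith
        _ = D := mul_one _
    have hsf0 : sf n w ≠ 0 := by
      rw [hsf, hf₁]
      exact mul_ne_zero (mul_ne_zero (inv_ne_zero hz0)
        (Complex.ofReal_ne_zero.2 (hEr0 n).ne')) (Complex.exp_ne_zero _)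
    have hY₀w := hY₀b w hw
    have hf3' : ‖f₃ (q n w) - 1‖ < ηY := hf3.trans_le hη₀Y
    have hdiff : ‖Yt n w - Y₀ w‖ < δu := by
      have hid : Yt n w - Y₀ w = Y₀ w * (f₃ (q n w) - 1) := by rw [hYt, hY₀]; ring
      rw [hid, norm_mul]
      have h1 : ‖f₃ (q n w) - 1‖ < δu / (2 * R₀) := hf3'.trans_le (min_le_left _ _)
      calc ‖Y₀ w‖ * ‖f₃ (q n w) - 1‖ ≤ R₀ * ‖f₃ (q n w) - 1‖ :=
            mul_le_mul_of_nonneg_right hY₀w (norm_nonneg _)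
        _ < R₀ * (δu / (2 * R₀)) + δu / 2 := by
            have := mul_le_mul_of_nonneg_left h1.le hR₀0.le
            linarith [half_pos hδu0]
        _ = δu := by field_simp; norm_num
    have hYtb : ‖Yt n w‖ ≤ R₁ := by
      have hid : Yt n w = Y₀ w * f₃ (q n w) := by rw [hYt, hY₀]
      rw [hid, norm_mul]
      have hf3'' : ‖f₃ (q n w)‖ ≤ 2 :=
        (norm_lt_two_of_norm_sub_one_lt hf3' ((min_le_right _ _).trans (by norm_num))).le
      calc ‖Y₀ w‖ * ‖f₃ (q n w)‖ ≤ R₀ * 2 := mul_le_mul hY₀w hf3'' (norm_nonneg _) hR₀0.le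
        _ ≤ R₁ := by rw [hR₁]; linarith
    exact ⟨hsfn, hsf0, hEn.trans_le ((min_le_right _ _).trans (min_le_left _ _)),
      hf1.trans_le ((min_le_left _ _).trans (min_le_right _ _)), hYtb, hdiff⟩
  -- for such `n`: a zero of `G n` in `ball w₀ r`
  have hzero : ∀ᶠ n : ℕ in atTop, 1 ≤ n ∧ ∃ w ∈ ball w₀ r, G n w = 0 := by
    filter_upwards [hmain] with n hn
    obtain ⟨hn1, hEn, hunif'⟩ := hn
    refine ⟨hn1, ?_⟩
    -- differentiability on `ball w₀ 2`
    have hdiff : DifferentiableOn ℂ (G n) (ball w₀ 2) := by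
      intro w hw
      have hw' : w ∈ closedBall w₀ 2 := ball_subset_closedBall hw
      obtain ⟨hslit, hf1, hf3⟩ := hunif' w hw'
      obtain ⟨hsfn, hsf0, -, -, -, -⟩ := hcons n hEn w hw' hf1 hf3
      have hqd : DifferentiableAt ℂ (q n) w := by
        rw [hq]
        simp only
        fun_prop
      have hlogd : DifferentiableAt ℂ (fun w => Complex.log (q n w)) w := hqd.clog hslit
      have hsfd : DifferentiableAt ℂ (sf n) w := by
        rw [hsf, hf₁]
        exact (differentiableAt_const _).mul (hlogd.neg.div_const _).cexp
      have hYtd : DifferentiableAt ℂ (Yt n) w := by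
        rw [hYt, hf₃]
        exact ((differentiableAt_const _).mul Complex.differentiable_exp.differentiableAt).mul
          (hlogd.const_mul _).cexp
      have hsum : DifferentiableAt ℂ
          (fun w => ∑ i ∈ Finset.range (d + 1), α i (sf n w) * (Yt n w) ^ i) w := by
        refine DifferentiableAt.fun_sum fun i hi => ?_
        exact ((hρ _ (hsfn.trans_le ((min_le_left _ _).trans (min_le_right _ _))) i hi).comp w
          hsfd).mul (hYtd.pow i)
      have hPw : DifferentiableAt ℂ (fun w => P (sf n w) (Yt n w)) w := by
        have h1 := (hPd (sf n w) (Yt n w) hsf0 (hsfn.trans_le (min_le_right _ _))).comp w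
          (hsfd.prodMk hYtd)
        exact h1
      have hGd : DifferentiableAt ℂ (G n) w := by
        rw [hG]
        exact hsum.add hPw
      exact hGd.differentiableWithinAt
    -- the uniform estimate `‖G n w − h w‖ < m/2` on `closedBall w₀ 2`
    have hest : ∀ w ∈ closedBall w₀ 2, ‖G n w - h w‖ < m / 2 := by
      intro w hw
      obtain ⟨hslit, hf1, hf3⟩ := hunif' w hw
      obtain ⟨hsfn, hsf0, hEnP, hf1P, hYtb, hYdiff⟩ := hcons n hEn w hw hf1 hf3
      -- (1) rows
      have h1 : ‖∑ i ∈ Finset.range (d + 1), (α i (sf n w) - α i 0) * (Yt n w) ^ i‖ ≤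
          (d + 1) * ε₁ * R₁ ^ d :=
        norm_rowSum_le hε₁0.le hR₁1 (fun i hi => (hδ₁ _ (hsfn.trans_le
          ((min_le_left _ _).trans (min_le_left _ _))) i hi).le) hYtb
      have h1' : ((d : ℝ) + 1) * ε₁ * R₁ ^ d = m / 6 := by
        rw [hε₁]
        field_simp
      -- (2) the edge polynomial, uniformly continuous
      have h2 : ‖Ef (Yt n w) - Ef (Y₀ w)‖ < m / 6 := by
        rw [← dist_eq_norm]
        refine hδu (Yt n w) ?_ (Y₀ w) ?_ ?_
        · rw [mem_closedBall, dist_zero_right]; exact hYtb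
        · rw [mem_closedBall, dist_zero_right]
          have := hY₀b w hw
          rw [hR₁]; linarith
        · rw [dist_eq_norm]; exact hYdiff
      -- (3) the perturbation
      have h3 : ‖P (sf n w) (Yt n w)‖ < m / 6 :=
        hPsmall (Er n) (f₁ (q n w)) (Yt n w) (hEr0 n) hEnP hf1P hYtb
      have hid : G n w - h w =
          ∑ i ∈ Finset.range (d + 1), (α i (sf n w) - α i 0) * (Yt n w) ^ i +
            (Ef (Yt n w) - Ef (Y₀ w)) + P (sf n w) (Yt n w) := by
        rw [hG, hh, hEf]
        simp only [sub_mul, Finset.sum_sub_distrib]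
        ring
      rw [hid]
      calc ‖∑ i ∈ Finset.range (d + 1), (α i (sf n w) - α i 0) * (Yt n w) ^ i +
              (Ef (Yt n w) - Ef (Y₀ w)) + P (sf n w) (Yt n w)‖
          ≤ ‖∑ i ∈ Finset.range (d + 1), (α i (sf n w) - α i 0) * (Yt n w) ^ i‖ +
              ‖Ef (Yt n w) - Ef (Y₀ w)‖ + ‖P (sf n w) (Yt n w)‖ := norm_add₃_le
        _ < m / 6 + m / 6 + m / 6 := by
            have := h1.trans_eq h1'
            linarith
        _ = m / 2 := by ring
    have hsph : ∀ w ∈ sphere w₀ r, m / 2 ≤ ‖G n w‖ := by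
      intro w hw
      have hw2 : w ∈ closedBall w₀ 2 :=
        sphere_subset_closedBall.trans (closedBall_subset_closedBall (by linarith)) hw
      have h1 := hm w hw
      have h2 := hest w hw2
      have h3 := norm_sub_norm_le (h w) (G n w)
      rw [norm_sub_rev (h w) (G n w)] at h3
      linarith
    have hcen : ‖G n w₀‖ < m / 2 := by
      have := hest w₀ (mem_closedBall_self (by norm_num))
      rwa [hhw₀, sub_zero] at this
    exact exists_zero_of_norm_lt_of_sphere hr0 (by linarith : r < 2) hdiff hsph hcen
  -- extract the sequence
  obtain ⟨N₁, hN₁⟩ := Filter.eventually_atTop.1 (hzero.and hmain)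
  set N₀ : ℕ := max N₁ 1 with hN₀
  have hN₀1 : 1 ≤ N₀ := le_max_right _ _
  have hP' : ∀ j : ℕ, (1 ≤ N₀ + j ∧ ∃ w ∈ ball w₀ r, G (N₀ + j) w = 0) ∧
      (1 ≤ N₀ + j ∧ Er (N₀ + j) < η₀ ∧ ∀ w ∈ closedBall w₀ 2, q (N₀ + j) w ∈ slitPlane ∧
        ‖f₁ (q (N₀ + j) w) - 1‖ < η₀ ∧ ‖f₃ (q (N₀ + j) w) - 1‖ < η₀) :=
    fun j => hN₁ (N₀ + j) ((le_max_left _ _).trans (Nat.le_add_right _ _))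
  choose w hwball hGw using fun j => (hP' j).1.2
  have hwcl : ∀ j, w j ∈ closedBall w₀ 2 := fun j =>
    (ball_subset_closedBall.trans (closedBall_subset_closedBall (by linarith))) (hwball j)
  -- `u_j = f₁(q_j) → 1`
  have hut : Tendsto (fun j => f₁ (q (N₀ + j) (w j))) atTop (𝓝 1) := by
    have hqt : Tendsto (fun j => q (N₀ + j) (w j)) atTop (𝓝 1) := by
      rw [tendsto_iff_norm_sub_tendsto_zero]
      have hδ' : Tendsto (fun j : ℕ => (‖a‖ * Real.log ((N₀ + j : ℕ) : ℝ) + (‖w₀‖ + 2)) /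
          (2 * Real.pi * ((N₀ + j : ℕ) : ℝ))) atTop (𝓝 0) :=
        (tendsto_log_label_div ‖a‖ (‖w₀‖ + 2)).comp
          (tendsto_add_atTop_nat N₀ |>.congr fun j => by ring_nf)
      refine squeeze_zero (fun j => norm_nonneg _) (fun j => ?_) hδ'
      exact norm_chartLabel_sub_one_le a w₀ (hP' j).1.1 (hwcl j)
    have hf1c : ContinuousAt f₁ 1 := by
      rw [hf₁]
      exact ((continuousAt_clog Complex.one_mem_slitPlane).neg.div_const _).cexp
    have hf11 : f₁ 1 = 1 := by simp [hf₁]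
    have := hf1c.tendsto.comp hqt
    rwa [hf11] at this
  refine ⟨N₀, fun j => f₁ (q (N₀ + j) (w j)), fun j => sf (N₀ + j) (w j), hN₀1, hut, ?_, ?_, ?_,
    ?_, ?_⟩
  · intro j
    exact Complex.exp_ne_zero _
  · intro j
    show z⁻¹ * ((Er (N₀ + j) : ℝ) : ℂ) * f₁ (q (N₀ + j) (w j)) = _
    rw [hEEr]
  · intro j
    simp only [hsf, hf₁]
    exact mul_ne_zero (mul_ne_zero (inv_ne_zero hz0)
      (Complex.ofReal_ne_zero.2 (hEr0 _).ne')) (Complex.exp_ne_zero _)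
  · -- `s_j → 0`
    have hE0 : Tendsto (fun j => ((Er (N₀ + j) : ℝ) : ℂ)) atTop (𝓝 0) := by
      have h1 : Tendsto (fun j => Er (N₀ + j)) atTop (𝓝 0) :=
        (tendsto_exp_neg_log_div k hk).comp (tendsto_add_atTop_nat N₀ |>.congr fun j => by ring_nf)
      have := Complex.continuous_ofReal.continuousAt.tendsto.comp h1
      rw [Complex.ofReal_zero] at this
      exact this
    have := ((tendsto_const_nhds (x := z⁻¹)).mul hE0).mul hut
    simpa [hsf] using this
  · -- the equation
    intro j
    set n : ℕ := N₀ + j with hn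
    have hn1 : 1 ≤ n := (hP' j).1.1
    obtain ⟨hslit, -, -⟩ := (hP' j).2.2.2 (w j) (hwcl j)
    have hGj : ∑ i ∈ Finset.range (d + 1), α i (sf n (w j)) * (Yt n (w j)) ^ i +
        P (sf n (w j)) (Yt n (w j)) = 0 := by
      have := hGw j
      rwa [hG] at this
    have hch := (chart_exp_mul_zpow_inv hk hz L hn1 (q := q n (w j)) (w := w j) (by rw [hq])
      hslit).2
    have hYeq : Complex.exp ((sf n (w j) ^ k)⁻¹) * (sf n (w j) ^ L)⁻¹ = Yt n (w j) := by
      rw [hsf, hYt, hf₃, hzL, hf₁]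
      simp only
      rw [← hEEr, hch]
    rw [hYeq]
    exact hGj

end Summit.Schanuel.Schanuel.Theorems

end
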